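import Mathlib.Data.Real.Basic
import Mathlib.Tactic.LinearCombination
import Mathlib.Tactic.Linarith
import Mathlib.Tactic.Positivity
import Summits.CriticalPhenomena.PercolationContinuityZ3.Theorems.PercNearOneGluingNoHeavyQuantLSCoreMMGIneqA
import Mathlib.Tactic.FieldSimp
import Mathlib.Tactic.Ring
import HarnessLib

/-!
# QUANT lane R8, T-DEC, binder (II) `ConvClosedTResidue`: LS-CORE, pattern LMG — polynomial certificates of the breakpoint inequalities (part K: auxiliary cell QNP (low 1 fits into the giant pool when the pairs (p+l′,p+h) and (m+l,p+h) are heavy))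

builds on p205010 (kernel theorem, internal audit signed; external expert review pending)

Support file (`--supports stmt-CriticalPhenomena-4575`), QUANT lane seat prim-quant-census-1 (gen 22), rung R8 of
`run/shared/lean/prim/quant/LADDER.md`.  Theorems only (real polynomial inequalities), standard axioms, no sorries.  Memo
`run/shared/lean/prim/quant/prim-quant-census-1/LSCORE-G22.md` (derivation of the forms), code `code/s5_final.py` (forms), `code/cert5.py`
(certificates: Handelman products of the region generators, LP by HiGHS, exact rational repair) in the seat folder of census-1 g22.

COORDINATES (memo §2).  The light slice `(1−γ)·shift_p ν_B + γ·shift_m ν_B` of the Type-I atom `ν_B` (lows `l < l′`, absorber `h`, light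
rate `ρ_ℓ < x`, expensive rate `ρ_e > x`) by the light credit pair `{p, m; γ}` (`γ = x² + (1−x)ρ_c`) is scale free in the unit `e = h − l′`:
`x` the floor, `r = ρ_ℓ`, `t = (l′ − l)/e`, `w = (m − p)/e ≤ 1` (the span ratio ω) and `d = ρ_c·w` (so `A = r + d` and `B = A + 2t` are the
deficits `(T − 2(p+l′))/e`, `(T − 2(p+l))/e` of the two lows, `D = t(2 − x² − (1−x)r) − x(x−r) > 0` the denominator of the tail weights
`λ = (x−r)(1−t−r)/D`, `λ′ = (1+x−r)(r−x+t(2−x))/D`).  Each lemma is ONE breakpoint inequality of the two-low greedy (`…QuantTwoLowGreedy`)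
on ONE light/heavy/absent branch of the six cross pairs, cleared of its (positive) denominators: `0 ≤ N` on the cell cut out by the listed
sign conditions, with an explicit certificate `N = Σ cᵢ·(product of conditions)`, `cᵢ ≥ 0`, replayed by `linear_combination`.

[this work].  Nothing here is cited as a published result.  The gluing rows served [cite: KozmaNitzan2024, Conjecture 3 (p. 15)];
product measure [cite: Grimmett1999, §1.3 p. 10].
-/

namespace Summit.CriticalPhenomena.PercolationContinuityZ3.Theorems

namespace Quant

namespace LawDec

namespace LSCoreLMG

set_option maxHeartbeats 8000000 in
set_option maxRecDepth 20000 in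
/-- **cell `LMG_QNP_2PH_3PH`** (auxiliary: `P₁ ≤ pool` (i.e. `(1−γ)λ ≤ γ`, cleared by `w·D`) whenever the head pair of low 2 and the pre-routing pair are heavy-or-absent; branch `2PH_3PH`: pre-routing case and light/heavy/absent letters of the cross pairs): the cleared obligation is an exact
nonnegative combination of 16 products of the region's sign conditions (LP certificate found with HiGHS, exact rational repair,
identity re-verified by an independent polynomial engine). [this work] -/
theorem lcell_QNP_2PH_3PH (x r t d w : ℝ) (h0 : 0 ≤ d) (h1 : 0 ≤ x * w - d) (h2 : 0 ≤ -t - r + 1) (h3 : 0 ≤ x * r * t - x ^ 2 * t - r * t + x * r - x ^ 2 + 2 * t) (h4 : 0 ≤ x * w - x * t - 2 * w + d + 2 * t + r - x) (h5 : 0 ≤ d + r - x) (h6 : 0 ≤ x) (h7 : 0 ≤ -x + 1) (h8 : 0 ≤ -r + x) (h9 : 0 ≤ w) (h10 : 0 ≤ -w + 1) (h11 : 0 ≤ t) :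
    0 ≤ x ^ 3 * r * t * w - x ^ 4 * t * w - x ^ 2 * r * t * d + x ^ 2 * r ^ 2 * w - x ^ 3 * t * w + x ^ 3 * t * d - x ^ 4 * w + x * r * t * d - x * r ^ 2 * d + 2 * x ^ 2 * t * w - x ^ 2 * r * w + x ^ 3 * w + x ^ 3 * d - r * t * w - r ^ 2 * w + r ^ 2 * d + x * t * w - 3 * x * t * d + x * r * w + x * r * d - 2 * x ^ 2 * d + 2 * t * d + r * w - r * d - x * w + x * d := by
  linear_combination (2 / 5 : ℝ) * (mul_nonneg h0 h3)
    + (3 / 5 : ℝ) * (mul_nonneg h1 h8)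
    + (3 / 5 : ℝ) * (mul_nonneg h3 h5)
    + (3 / 5 : ℝ) * (mul_nonneg h4 h8)
    + (3 / 5 : ℝ) * (mul_nonneg (mul_nonneg h0 h2) h8)
    + (1 : ℝ) * (mul_nonneg (mul_nonneg h1 h3) h6)
    + (3 / 5 : ℝ) * (mul_nonneg (mul_nonneg h1 h7) h8)
    + (3 / 5 : ℝ) * (mul_nonneg (mul_nonneg h3 h8) h9)
    + (3 / 5 : ℝ) * (mul_nonneg (mul_nonneg h5 h7) h8)
    + (1 / 5 : ℝ) * (mul_nonneg (mul_nonneg (mul_nonneg h0 h2) h7) h8)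
    + (2 / 5 : ℝ) * (mul_nonneg (mul_nonneg (mul_nonneg h1 h2) h6) h8)
    + (6 / 5 : ℝ) * (mul_nonneg (mul_nonneg (mul_nonneg h7 h8) h8) h10)
    + (1 / 5 : ℝ) * (mul_nonneg (mul_nonneg (mul_nonneg (mul_nonneg h0 h2) h7) h7) h8)
    + (1 / 5 : ℝ) * (mul_nonneg (mul_nonneg (mul_nonneg (mul_nonneg h1 h2) h6) h6) h8)
    + (3 / 5 : ℝ) * (mul_nonneg (mul_nonneg (mul_nonneg (mul_nonneg h7 h8) h8) h10) h11)
    + (1 / 5 : ℝ) * (mul_nonneg (mul_nonneg (mul_nonneg (mul_nonneg (mul_nonneg h2 h7) h7) h7) h8) h9)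

set_option maxHeartbeats 4000000 in
/-- **`P₁ ≤ pool` when the pairs `(p+l′, p+h)` and `(m+l, p+h)` are heavy-or-absent** (`x ≤ A`, `x(1+t−w) ≤ B − 2w`): the far low `p+l`
(mass `(1−γ)(1−x)λ`) fits into the giant pool `γ(1−x)` by itself, so the head-cell breakpoint `kB` of the two-low greedy is immediate on
these branches (`F_B = (bracket − P₂)·κ + (pool − P₁)` with both summands nonnegative).  From `lcell_QNP_2PH_3PH` by dividing by `w·D > 0`.
[this work] -/
theorem P1_le_pool_2PH_3PH (x r t d w : ℝ) (hx0 : 0 < x) (hx1 : x < 1) (hr0 : 0 ≤ r) (hrx : r < x) (ht : 0 < t)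
    (hw0 : 0 < w) (hw1 : w ≤ 1) (hd0 : 0 ≤ d) (hdx : d < x * w) (hre : 0 < r - x + t * (2 - x)) (hre1 : 0 < 1 - t - r)
    (h2H : x ≤ r + d) (h3H : x * (1 + t - w) ≤ r + d + 2 * t - 2 * w) :
    ((1 - (x ^ 2 + (1 - x) * d / w)) * (1 - x) * ((x - r) * (1 - t - r) / (t * (2 - x ^ 2 - (1 - x) * r) - x * (x - r)))) ≤ ((x ^ 2 + (1 - x) * d / w) * (1 - x)) := by
  have hD : 0 < (t * (2 - x ^ 2 - (1 - x) * r) - x * (x - r)) := LSCoreMMG.D_pos x r t hx0 hx1 hr0 hrx hre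
  have hN := lcell_QNP_2PH_3PH x r t d w hd0 (by linarith) (by linarith) (by nlinarith [hD]) (by nlinarith [h3H]) (by linarith)
    hx0.le (by linarith) (by linarith) hw0.le (by linarith) ht.le
  have hDne : (t * (2 - x ^ 2 - (1 - x) * r) - x * (x - r)) ≠ 0 := hD.ne'
  have hwne : w ≠ 0 := hw0.ne'
  have key : ((x ^ 2 + (1 - x) * d / w) * (1 - x)) - ((1 - (x ^ 2 + (1 - x) * d / w)) * (1 - x) * ((x - r) * (1 - t - r) / (t * (2 - x ^ 2 - (1 - x) * r) - x * (x - r))))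
      = (1 - x) * (x ^ 3 * r * t * w - x ^ 4 * t * w - x ^ 2 * r * t * d + x ^ 2 * r ^ 2 * w - x ^ 3 * t * w + x ^ 3 * t * d - x ^ 4 * w + x * r * t * d - x * r ^ 2 * d + 2 * x ^ 2 * t * w - x ^ 2 * r * w + x ^ 3 * w + x ^ 3 * d - r * t * w - r ^ 2 * w + r ^ 2 * d + x * t * w - 3 * x * t * d + x * r * w + x * r * d - 2 * x ^ 2 * d + 2 * t * d + r * w - r * d - x * w + x * d) / (w * (t * (2 - x ^ 2 - (1 - x) * r) - x * (x - r))) := by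
    field_simp
    ring
  have h2 : 0 ≤ (1 - x) * (x ^ 3 * r * t * w - x ^ 4 * t * w - x ^ 2 * r * t * d + x ^ 2 * r ^ 2 * w - x ^ 3 * t * w + x ^ 3 * t * d - x ^ 4 * w + x * r * t * d - x * r ^ 2 * d + 2 * x ^ 2 * t * w - x ^ 2 * r * w + x ^ 3 * w + x ^ 3 * d - r * t * w - r ^ 2 * w + r ^ 2 * d + x * t * w - 3 * x * t * d + x * r * w + x * r * d - 2 * x ^ 2 * d + 2 * t * d + r * w - r * d - x * w + x * d) / (w * (t * (2 - x ^ 2 - (1 - x) * r) - x * (x - r))) :=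
    div_nonneg (mul_nonneg (by linarith) hN) (mul_pos hw0 hD).le
  linarith [key, h2]

end LSCoreLMG

end LawDec

end Quant

end Summit.CriticalPhenomena.PercolationContinuityZ3.Theorems
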